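import Literature.NumberTheory.EllipticCurves.NewformPeterssonSizeSymmSqLZeroFreeProofs
import Literature.NumberTheory.LFunctions.SiegelZeroLemmaGHL
import HarnessLib

/-!
# Murty's bound `(f, f) ≫_ε N^{1−ε}` from a Goldfeld–Hoffstein–Lieman auxiliary function
# (the effective, diagonal route: no Siegel pairs, no twist comparison)

Topic `NumberTheory/EllipticCurves`; namespace `Literature.NumberTheory.EllipticCurves.ModularForms`.
Proof file (theorems only; no definition, no named fact — D-0026) of the `provefact` unit of the
named fact `murty_petersson_newform_lower_bound` (`NewformPeterssonSize.lean`).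

The tree now proves (i) `murty_petersson_newform_lower_bound_of_symmSqL_noExceptionalZero`
(`NewformPeterssonSizeSymmSqLZeroFreeProofs`): the named fact follows from ONE constant `A > 0` such
that `L_f(σ) = symmSqL N f σ ≠ 0` for `1 − 1/(A log(N+2)) ≤ σ < 1`, for the newform `f` of every
elliptic curve over `ℚ`; and (ii) the abstract Siegel-zero lemma of Goldfeld–Hoffstein–Lieman
(`GoldfeldHoffsteinLieman1994.realZero_le_of_analyticOrderAt`, `LFunctions/SiegelZeroLemmaGHL`): an
entire `F` with `F(1 − s) = F(s)`, order `< 2`, zeros in `Re s ≤ 1` and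
`Re F'/F(σ) ≤ m/(σ − 1) + 𝓛` on `(1, 2]` has no real zero of multiplicity `≥ m + 1` in
`(1 − c_m/𝓛, 1]`, `c_m = 1/(2(2m+1))`. This file combines them:

* `symmSqL_zeroFree_of_GHL_aux` — if for the newform `f` of an elliptic curve of conductor `N` there
  is such an `F` with `𝓛 = B log N + C` vanishing to order `≥ m + 1` at every real zero
  `σ ∈ [1 − η₁, 1)` of `L_f`, then `L_f(σ) ≠ 0` for `1 − 1/(A log(N+2)) ≤ σ < 1`, with
  `A = A(m, B, C, η₁)` explicit and independent of `f`;
* `murty_petersson_newform_lower_bound_of_GHL_aux` — **the named fact holds if every newform of an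
  elliptic curve over `ℚ` admits a Goldfeld–Hoffstein–Lieman auxiliary function** with uniform
  `B, C, η₁` and bounded pole order `m ≤ m₀`.

**The model** ([HoffsteinLockhart1994], Appendix; Goldfeld §8.7 (8.7.2) and the proof of Thm. 8.7.6,
read: PDF pp. 197–198). For `f` not of CM type let `Φ` be its Gelbart–Jacquet lift (a cusp form on
`GL(3)`, the unproved named fact `Literature.NumberTheory.Automorphic.GelbartJacquet_symmSq_cuspidal`)
and `Z(s) = ζ(s) L(s, Φ)² L(s, Φ × Φ)` — non-negative coefficients of `−Z'/Z`, a pole of order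
`m = 2` at `s = 1`, and "any zero of `L_Φ(s)` will be a zero of `Z(s)` with order at least 3"; then
`F(s) = (s(1 − s))² Λ_Z(s)` (completed) is entire of order `1`, `F(1 − s) = F(s)`, its zeros lie in the
critical strip, `Re F'/F(σ) ≤ 2/(σ−1) + 2/σ + log(conductor) + Re G'/G(σ)` with
`log(conductor) ≪ log N` — exactly the hypotheses below, with the link to `L_f` because the real zeros
of `L_f` in `(0, 1)` are those of `L(s, Φ) = L(s, Sym² f)` (finitely many positive local factors). For
CM forms the same shape is supplied by Hecke `L`-functions of the CM field
(`ζ_K³ L(ψ²)²L(ψ̄²)²L(ψ⁴)L(ψ̄⁴)`, `m = 3`, a real zero of `L(s, ψ²)` has multiplicity `≥ 4`), the factor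
`L(s, χ_K)` of `L(s, Sym² f)` being zero-free near `1` for the nine CM fields. NONE of these analytic
inputs (`GL(3)` Rankin–Selberg theory, Hecke characters of imaginary quadratic fields) has a carrier in
the tree; this file isolates them as ONE existential analytic datum per form.

## References

* [HoffsteinLockhart1994] J. Hoffstein, P. Lockhart, Ann. of Math. 140 (1994) 161–181, Thm. 0.1, and the
  Appendix by D. Goldfeld, J. Hoffstein, D. Lieman, pp. 177–181 (Lemma and Theorem).
* [Goldfeld2006] D. Goldfeld, *Automorphic Forms and L-Functions for the Group GL(n, ℝ)*, §8.6
  Lemma 8.6.1, §8.7 (8.7.2) and Thm. 8.7.6 (read: PDF pp. 196–198).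
* [MurtyCongruencePrimes1999] M. R. Murty, *Bounds for congruence primes*, §2.
-/

noncomputable section

namespace Literature.NumberTheory.EllipticCurves.ModularForms

open Literature.NumberTheory.LFunctions
open Set Filter Metric Complex CongruenceSubgroup
open scoped Real Topology

/-- **A GHL auxiliary function forces a zero-free interval `[1 − 1/(A log(N+2)), 1)` for `L_f`.**
Let `m : ℕ`, `B, C : ℝ`, `η₁ > 0`, and put
`A = 4(2m+1)(1/log 2 + |B| + |C|/log 2) + 1/(η₁ log 2)`. If `f ∈ S₂(Γ₀(N))` and there is an entire `F`
with `F(1 − s) = F(s)`, `‖F(s)‖ ≤ C_g exp(‖s‖^μ)` (`0 ≤ μ < 2`), all zeros in `Re s ≤ 1`,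
`Re F'/F(σ) ≤ m/(σ−1) + (B log N + C)` for `1 < σ ≤ 2`, and `ord_σ F ≥ m + 1` at every real zero
`σ ∈ [1 − η₁, 1)` of `L_f = symmSqL N f`, then `L_f(σ) ≠ 0` for `1 − 1/(A log(N+2)) ≤ σ < 1`
(`GoldfeldHoffsteinLieman1994.realZero_le_of_analyticOrderAt` with `𝓛 = max(1, B log N + C) ≤
(1/log 2 + |B| + |C|/log 2) log(N+2)`, so an excluded zero would satisfy
`1 − 1/(A log(N+2)) ≤ σ ≤ 1 − c_m/𝓛 < 1 − 1/(A log(N+2))`).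
[cite: Goldfeld2006, §8.6 Lemma 8.6.1 and §8.7 (proof of Thm. 8.7.6)] [cite: HoffsteinLockhart1994, Appendix (Goldfeld–Hoffstein–Lieman)] -/
theorem symmSqL_zeroFree_of_GHL_aux {m : ℕ} {B C η₁ : ℝ} (hη₁ : 0 < η₁)
    {N : ℕ} [NeZero N] (f : CuspForm (Gamma0 N) 2)
    (hF : ∃ (F : ℂ → ℂ) (Cg μ : ℝ), Differentiable ℂ F ∧ (∀ s, F (1 - s) = F s) ∧ μ < 2 ∧ 0 ≤ μ ∧
      (∀ s, ‖F s‖ ≤ Cg * Real.exp (‖s‖ ^ μ)) ∧ (∀ s, F s = 0 → s.re ≤ 1) ∧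
      (∀ σ : ℝ, 1 < σ → σ ≤ 2 → (logDeriv F σ).re ≤ m / (σ - 1) + (B * Real.log N + C)) ∧
      (∀ σ : ℝ, 1 - η₁ ≤ σ → σ < 1 → symmSqL N f σ = 0 → ((m + 1 : ℕ) : ℕ∞) ≤ analyticOrderAt F σ)) :
    ∀ σ : ℝ, 1 - 1 / ((4 * (2 * m + 1) * (1 / Real.log 2 + |B| + |C| / Real.log 2) + 1 / (η₁ * Real.log 2)) *
      Real.log (N + 2)) ≤ σ → σ < 1 → symmSqL N f σ ≠ 0 := by
  obtain ⟨F, Cg, μ, hFd, hsymm, hμ, hμ0, hgrowth, hzero, hbound, hord⟩ := hF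
  intro σ h1σ h2σ h0
  have hm0 : (0 : ℝ) ≤ m := Nat.cast_nonneg m
  have hlog2 : (1 : ℝ) / 2 < Real.log 2 := by have := Real.log_two_gt_d9; linarith
  have hlog20 : (0 : ℝ) < Real.log 2 := by linarith
  have hN0 : (0 : ℝ) < N := Nat.cast_pos.mpr (NeZero.pos N)
  have hN1 : (1 : ℝ) ≤ N := by exact_mod_cast NeZero.one_le
  have hlogN : Real.log 2 ≤ Real.log (N + 2) := Real.log_le_log (by norm_num) (by linarith)
  have hlogN0 : 0 < Real.log (N + 2) := by linarith
  have hlogN' : Real.log N ≤ Real.log (N + 2) := Real.log_le_log hN0 (by linarith)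
  have hlogNn : 0 ≤ Real.log N := Real.log_nonneg hN1
  -- names
  set K : ℝ := 1 / Real.log 2 + |B| + |C| / Real.log 2 with hKdef
  have hK0 : 0 < K := by positivity
  set A : ℝ := 4 * (2 * m + 1) * K + 1 / (η₁ * Real.log 2) with hAdef
  have hA0 : 0 < A := by positivity
  have hAlog : 0 < A * Real.log (N + 2) := by positivity
  -- `𝓛 = max 1 (B log N + C) ≤ K log(N+2)`
  set 𝓛 : ℝ := max 1 (B * Real.log N + C) with h𝓛def
  have h𝓛1 : 1 ≤ 𝓛 := le_max_left _ _
  have h𝓛0 : 0 < 𝓛 := by linarith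
  have h𝓛K : 𝓛 ≤ K * Real.log (N + 2) := by
    rw [h𝓛def, max_le_iff]
    constructor
    · calc (1 : ℝ) = 1 / Real.log 2 * Real.log 2 := by field_simp
        _ ≤ 1 / Real.log 2 * Real.log (N + 2) := by gcongr
        _ ≤ K * Real.log (N + 2) := by
            gcongr; rw [hKdef]
            have : 0 ≤ |B| + |C| / Real.log 2 := by positivity
            linarith
    · have hB : B * Real.log N ≤ |B| * Real.log (N + 2) :=
        calc B * Real.log N ≤ |B| * Real.log N := by gcongr; exact le_abs_self B
          _ ≤ |B| * Real.log (N + 2) := by gcongr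
      have hC : C ≤ |C| / Real.log 2 * Real.log (N + 2) :=
        calc C ≤ |C| := le_abs_self C
          _ = |C| / Real.log 2 * Real.log 2 := by field_simp
          _ ≤ |C| / Real.log 2 * Real.log (N + 2) := by gcongr
      calc B * Real.log N + C ≤ |B| * Real.log (N + 2) + |C| / Real.log 2 * Real.log (N + 2) := by linarith
        _ = (|B| + |C| / Real.log 2) * Real.log (N + 2) := by ring
        _ ≤ K * Real.log (N + 2) := by
            gcongr; rw [hKdef]
            have : 0 ≤ 1 / Real.log 2 := by positivity
            linarith
  -- the hypothesis window: `1/(A log(N+2)) ≤ η₁`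
  have hwin : 1 / (A * Real.log (N + 2)) ≤ η₁ := by
    rw [one_div_le hAlog hη₁]
    calc 1 / η₁ = 1 / (η₁ * Real.log 2) * Real.log 2 := by field_simp
      _ ≤ 1 / (η₁ * Real.log 2) * Real.log (N + 2) := by gcongr
      _ ≤ A * Real.log (N + 2) := by
          gcongr; rw [hAdef]
          have : 0 ≤ 4 * (2 * (m : ℝ) + 1) * K := by positivity
          linarith
  have hσwin : 1 - η₁ ≤ σ := by linarith
  -- the GHL lemma
  have hbound' : ∀ σ' : ℝ, 1 < σ' → σ' ≤ 2 → (logDeriv F σ').re ≤ m / (σ' - 1) + 𝓛 := fun σ' h1 h2 ↦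
    (hbound σ' h1 h2).trans (by gcongr; exact le_max_right _ _)
  have hGHL := GoldfeldHoffsteinLieman1994.realZero_le_of_analyticOrderAt hFd hsymm hμ hμ0 hgrowth hzero
    h𝓛1 hbound' h2σ.le (hord σ hσwin h2σ h0)
  -- `1/(A log(N+2)) < c_m/𝓛`
  have hstrict : 1 / (A * Real.log (N + 2)) < 1 / (2 * (2 * m + 1)) / 𝓛 := by
    have hKlog : 0 < K * Real.log (N + 2) := by positivity
    calc 1 / (A * Real.log (N + 2)) ≤ 1 / (4 * (2 * m + 1) * K * Real.log (N + 2)) := by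
          apply one_div_le_one_div_of_le (by positivity)
          rw [hAdef]
          have : 0 ≤ 1 / (η₁ * Real.log 2) * Real.log (N + 2) := by positivity
          nlinarith
      _ = 1 / (2 * (2 * m + 1)) / (2 * (K * Real.log (N + 2))) := by
          field_simp; ring
      _ < 1 / (2 * (2 * m + 1)) / (K * Real.log (N + 2)) := by
          apply div_lt_div_of_pos_left (by positivity) hKlog
          linarith
      _ ≤ 1 / (2 * (2 * m + 1)) / 𝓛 := by
          apply div_le_div_of_nonneg_left (by positivity) h𝓛0 h𝓛K
  linarith

/-- **`murty_petersson_newform_lower_bound` holds if every newform of an elliptic curve over `ℚ`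
admits a Goldfeld–Hoffstein–Lieman auxiliary function.** Suppose there are `m₀ : ℕ`, `B, C : ℝ` and
`η₁ > 0` such that for every `N`, every elliptic `E/ℚ` and every `f ∈ S₂(Γ₀(N))` with `IsNewformOf E f`
there are `m ≤ m₀` and an entire `F` with `F(1 − s) = F(s)`, `‖F(s)‖ ≤ C_g exp(‖s‖^μ)` for some `0 ≤ μ < 2`, all zeros
in `Re s ≤ 1`, `Re F'/F(σ) ≤ m/(σ − 1) + B log N + C` for `1 < σ ≤ 2`, and `ord_σ F ≥ m + 1` at every
real zero `σ ∈ [1 − η₁, 1)` of `L_f = symmSqL N f` (model: `F = (s(1−s))² Λ(s, ζ · L(Sym² f)² ·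
L(Sym² f × Sym² f))`, `m = 2`, for non-CM `f` — Goldfeld–Hoffstein–Lieman; a Hecke-character analogue
with `m = 3` for CM `f`, whence the bound `m ≤ m₀` rather than one `m`). Then `murty_petersson_newform_lower_bound`: by `symmSqL_zeroFree_of_GHL_aux` every `L_f`
is zero-free on `[1 − 1/(A log(N+2)), 1)` with one `A = A(m₀, B, C, η₁)` (the window shrinks as `m`
grows), and
`murty_petersson_newform_lower_bound_of_symmSqL_noExceptionalZero` applies. This is the EFFECTIVE route
(the bound obtained on the way is `(f,f) ≥ c N/log(N+2)`), conditional only on the existence of the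
auxiliary functions. [cite: HoffsteinLockhart1994, Thm. 0.1 and Appendix (Goldfeld–Hoffstein–Lieman)] [cite: Goldfeld2006, §8.7 Thm. 8.7.6 (proof)] [cite: MurtyCongruencePrimes1999, §2] -/
theorem murty_petersson_newform_lower_bound_of_GHL_aux
    (h : ∃ (m₀ : ℕ) (B C η₁ : ℝ), 0 < η₁ ∧ ∀ (N : ℕ) [NeZero N] (W : WeierstrassCurve ℚ) [W.IsElliptic]
      (f : CuspForm (Gamma0 N) 2), IsNewformOf W f →
        ∃ (m : ℕ) (F : ℂ → ℂ) (Cg μ : ℝ), m ≤ m₀ ∧ Differentiable ℂ F ∧ (∀ s, F (1 - s) = F s) ∧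
          μ < 2 ∧ 0 ≤ μ ∧ (∀ s, ‖F s‖ ≤ Cg * Real.exp (‖s‖ ^ μ)) ∧ (∀ s, F s = 0 → s.re ≤ 1) ∧
          (∀ σ : ℝ, 1 < σ → σ ≤ 2 → (logDeriv F σ).re ≤ m / (σ - 1) + (B * Real.log N + C)) ∧
          (∀ σ : ℝ, 1 - η₁ ≤ σ → σ < 1 → symmSqL N f σ = 0 →
            ((m + 1 : ℕ) : ℕ∞) ≤ analyticOrderAt F σ)) :
    murty_petersson_newform_lower_bound := by
  obtain ⟨m₀, B, C, η₁, hη₁, hF⟩ := h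
  have hlog20 : (0 : ℝ) < Real.log 2 := Real.log_pos (by norm_num)
  set K : ℝ := 1 / Real.log 2 + |B| + |C| / Real.log 2 with hKdef
  have hK0 : 0 < K := by positivity
  refine murty_petersson_newform_lower_bound_of_symmSqL_noExceptionalZero
    ⟨4 * (2 * m₀ + 1) * K + 1 / (η₁ * Real.log 2), by positivity, fun N _ W _ f hf σ h1σ h2σ ↦ ?_⟩
  obtain ⟨m, F, Cg, μ, hm, hrest⟩ := hF N W f hf
  have hZ := symmSqL_zeroFree_of_GHL_aux (m := m) (B := B) (C := C) hη₁ f ⟨F, Cg, μ, hrest⟩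
  refine hZ σ (le_trans ?_ h1σ) h2σ
  -- the window for `m ≤ m₀` contains the window for `m₀`
  have hN0 : (0 : ℝ) ≤ N := Nat.cast_nonneg N
  have hlogN0 : 0 < Real.log (N + 2) := Real.log_pos (by linarith)
  have hmR : (m : ℝ) ≤ m₀ := by exact_mod_cast hm
  have hA0 : 0 < 4 * (2 * (m : ℝ) + 1) * K + 1 / (η₁ * Real.log 2) := by positivity
  have hAle : 4 * (2 * (m : ℝ) + 1) * K + 1 / (η₁ * Real.log 2) ≤
      4 * (2 * (m₀ : ℝ) + 1) * K + 1 / (η₁ * Real.log 2) := by gcongr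
  have : 1 / ((4 * (2 * (m₀ : ℝ) + 1) * K + 1 / (η₁ * Real.log 2)) * Real.log (N + 2)) ≤
      1 / ((4 * (2 * (m : ℝ) + 1) * K + 1 / (η₁ * Real.log 2)) * Real.log (N + 2)) := by
    apply one_div_le_one_div_of_le (by positivity)
    exact mul_le_mul_of_nonneg_right hAle hlogN0.le
  simp only [hKdef] at this ⊢
  linarith

end Literature.NumberTheory.EllipticCurves.ModularForms

end
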